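import Summits.QuantumFields.YangMills.Theorems.LuscherReductionRunningReductionPolyakovLine
import HarnessLib

/-!
# The INNER piece is a sum of eight disjoint twisted copies (sub-stub C2f of the fixed-lattice programme COARSE(L₀) — route
# `LuscherReduction`, crux RED stmt-QuantumFields-19978 KT-door 3b′ / crux `TwistedTraceScaling` stmt-QuantumFields-20203 S-BASE;
# design note `pub/ym-fleet/ym-luscher-20007-p1/COARSE-DESIGN.md` §2, §7 brick (i))

The INNER piece `cos Θ_δ · ψ` of the lattice IMS split (`qform_le_inner_outer_lat`, `qform_le_three_regions_lat`) lives in the union of the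
eight neighbourhoods `{orbitDist (twist3 z U) < δ}` of the twisted pure-gauge orbits.  For `L·δ < 2` these are pairwise DISJOINT
(`twist3_eq_of_orbitDist_lt`, previous file), so a physical zero-flux `ψ` decomposes there into eight copies of ONE function localized at the
trivial orbit:
* `twistSum φ = Σ_z φ ∘ twist3 z` — the twist symmetrisation; it is physical zero-flux as soon as `φ` is bounded, measurable and gauge invariant
  (`isPhys_twistSum`);
* `innerCut δ U = sin((π/2)·bump(orbitDist U/δ)) ∈ [0,1]`, gauge invariant, vanishing off `{orbitDist U < δ}`;
* ★ `cos_innerPhase_eq_twistSum` — for `L·δ < 2`: `cos Θ_δ(U) = Σ_z innerCut δ (twist3 z U)`, hence `cos Θ_δ · ψ = twistSum (innerCut δ · ψ)`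
  for physical `ψ` (`cos_innerPhase_mul_eq_twistSum`);
* ★ `l2_twistSum` — for `φ` vanishing off `{orbitDist < δ}`, `L·δ < 2`: `‖twistSum φ‖² = 8‖φ‖²` (disjoint supports + twist invariance of the
  a-priori measure).
So both directions of the INNER Born–Oppenheimer comparison (C4) may work with ONE gauge-invariant function localized at the trivial orbit (no twist
condition), exactly as the one-site analysis does with its eight sign classes.  The transfer-form companion (cross terms between different copies are
`O(e^{2β|E|} e^{−βm²/(2|E|)})`) is the next file.
HONEST FRAMING: region bookkeeping on a fixed lattice; femto rung R2b1; not a gap, not infinite volume, not Clay.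
-/

set_option autoImplicit false

noncomputable section

open MeasureTheory Filter Topology Real
open scoped Matrix ComplexConjugate BigOperators
open Literature.MathematicalPhysics.QuantumFieldTheory
open Literature.MathematicalPhysics.QuantumLattice

namespace Summit.QuantumFields.YangMills.Theorems.FemtoTransferGap

variable {L : ℕ} [NeZero L]

/-! ## §1 Twist symmetrisation -/

/-- **Twist symmetrisation** `twistSum φ (U) = Σ_{z ∈ (ℤ/2)³} φ(twist3 z U)`. [cite: tHooft1979] -/
def twistSum (φ : GaugeConfig 3 L SU2 → ℝ) (U : GaugeConfig 3 L SU2) : ℝ := ∑ z : Fin 3 → Bool, φ (TT.twist3 z U)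

omit [NeZero L] in
/-- `z ↦ z + w` is an involution of `(ℤ/2)³`. [folklore] -/
theorem xor_involutive (w : Fin 3 → Bool) : Function.Involutive (fun z : Fin 3 → Bool => fun k => Bool.xor (z k) (w k)) := by
  intro z; funext k; simp

omit [NeZero L] in
/-- `twistSum φ` is invariant under composite twists (reindex the sum by `z ↦ z + w`). [folklore] -/
theorem twistSum_twist3 (φ : GaugeConfig 3 L SU2 → ℝ) (w : Fin 3 → Bool) (U : GaugeConfig 3 L SU2) :
    twistSum φ (TT.twist3 w U) = twistSum φ U := by
  unfold twistSum
  refine Fintype.sum_bijective (fun z : Fin 3 → Bool => fun k => Bool.xor (z k) (w k)) (xor_involutive w).bijective _ _ fun z => ?_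
  rw [TT.twist3_twist3]

omit [NeZero L] in
/-- `twistSum φ` is invariant under the three centre twists. [folklore] -/
theorem twistSum_twist (φ : GaugeConfig 3 L SU2 → ℝ) (k : Fin 3) {c : SU2} (hc : c ∈ Subgroup.center SU2) (U : GaugeConfig 3 L SU2) :
    twistSum φ (twist k c U) = twistSum φ U := by
  obtain ⟨b, rfl⟩ := TT.exists_eq_centreElem_of_mem_center hc
  rw [TT.twist_centreElem_eq_twist3, twistSum_twist3]

omit [NeZero L] in
/-- `twistSum φ` is gauge invariant if `φ` is (gauge transformations commute with twists). [folklore] -/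
theorem twistSum_gaugeTransform {φ : GaugeConfig 3 L SU2 → ℝ} (hφ : ∀ (g : Site 3 L → SU2) (U : GaugeConfig 3 L SU2), φ (gaugeTransform g U) = φ U)
    (g : Site 3 L → SU2) (U : GaugeConfig 3 L SU2) : twistSum φ (gaugeTransform g U) = twistSum φ U := by
  unfold twistSum
  refine Finset.sum_congr rfl fun z _ => ?_
  rw [← TT.gaugeTransform_twist3, hφ]

/-- `twistSum φ` is measurable if `φ` is. [folklore] -/
theorem measurable_twistSum {φ : GaugeConfig 3 L SU2 → ℝ} (hφ : Measurable φ) : Measurable (twistSum (L := L) φ) := by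
  unfold twistSum
  exact Finset.measurable_sum _ fun z _ => hφ.comp (TT.measurable_twist3 z)

omit [NeZero L] in
/-- `|twistSum φ| ≤ 8C` if `|φ| ≤ C`. [folklore] -/
theorem abs_twistSum_le {φ : GaugeConfig 3 L SU2 → ℝ} {C : ℝ} (hC : ∀ U, |φ U| ≤ C) (U : GaugeConfig 3 L SU2) :
    |twistSum φ U| ≤ 8 * C := by
  unfold twistSum
  calc |∑ z : Fin 3 → Bool, φ (TT.twist3 z U)| ≤ ∑ z : Fin 3 → Bool, |φ (TT.twist3 z U)| := Finset.abs_sum_le_sum_abs _ _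
    _ ≤ ∑ _z : Fin 3 → Bool, C := Finset.sum_le_sum fun z _ => hC _
    _ = 8 * C := by simp

/-- ★ **`twistSum φ` is a physical zero-flux test function** whenever `φ` is bounded, measurable and gauge invariant. [cite: Luscher1983, §2] -/
theorem isPhys_twistSum {φ : GaugeConfig 3 L SU2 → ℝ} (hm : Measurable φ) (hb : ∃ C : ℝ, ∀ U, |φ U| ≤ C)
    (hg : ∀ (g : Site 3 L → SU2) (U : GaugeConfig 3 L SU2), φ (gaugeTransform g U) = φ U) : IsPhys (twistSum φ) where
  measurable := measurable_twistSum hm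
  bounded := by obtain ⟨C, hC⟩ := hb; exact ⟨8 * C, abs_twistSum_le hC⟩
  gaugeInv := twistSum_gaugeTransform hg
  zeroFlux := fun k c hc U => twistSum_twist φ k hc U

omit [NeZero L] in
/-- For a physical (twist-invariant) `ψ`: `twistSum (φ·ψ) = (twistSum φ)·ψ`. [folklore] -/
theorem twistSum_mul_of_isPhys (φ : GaugeConfig 3 L SU2 → ℝ) {ψ : GaugeConfig 3 L SU2 → ℝ} (hψ : IsPhys ψ) (U : GaugeConfig 3 L SU2) :
    twistSum (fun V => φ V * ψ V) U = twistSum φ U * ψ U := by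
  unfold twistSum
  rw [Finset.sum_mul]
  exact Finset.sum_congr rfl fun z _ => by beta_reduce; rw [TT.twist3_eq_of_isPhys hψ]

/-! ## §2 The one-orbit cut-off -/

/-- **One-orbit inner cut-off** `innerCut δ U = sin((π/2)·bump(orbitDist U / δ))`: equal to `1` for `orbitDist U ≤ δ/2`, to `0` for
`orbitDist U ≥ δ`. [cite: SimonB1983DiscreteSpectrum, §3] -/
def innerCut (δ : ℝ) (U : GaugeConfig 3 L SU2) : ℝ := Real.sin (π / 2 * bump (orbitDist U / δ))

/-- The argument of the `sin` lies in `[0, π/2]`. [folklore] -/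
theorem innerCut_arg_mem (δ : ℝ) (U : GaugeConfig 3 L SU2) :
    0 ≤ π / 2 * bump (orbitDist U / δ) ∧ π / 2 * bump (orbitDist U / δ) ≤ π / 2 := by
  constructor
  · exact mul_nonneg (by positivity) (bump_nonneg _)
  · calc π / 2 * bump (orbitDist U / δ) ≤ π / 2 * 1 := mul_le_mul_of_nonneg_left (bump_le_one _) (by positivity)
      _ = π / 2 := mul_one _

/-- `0 ≤ innerCut δ U`. [folklore] -/
theorem innerCut_nonneg (δ : ℝ) (U : GaugeConfig 3 L SU2) : 0 ≤ innerCut δ U := by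
  have h := innerCut_arg_mem δ U
  exact Real.sin_nonneg_of_nonneg_of_le_pi h.1 (h.2.trans (by linarith [Real.pi_pos]))

/-- `innerCut δ U ≤ 1`. [folklore] -/
theorem innerCut_le_one (δ : ℝ) (U : GaugeConfig 3 L SU2) : innerCut δ U ≤ 1 := Real.sin_le_one _

/-- `|innerCut δ U| ≤ 1`. [folklore] -/
theorem abs_innerCut_le (δ : ℝ) (U : GaugeConfig 3 L SU2) : |innerCut δ U| ≤ 1 := by
  rw [abs_of_nonneg (innerCut_nonneg δ U)]; exact innerCut_le_one δ U

/-- `innerCut δ U = 0` once `orbitDist U ≥ δ` (`δ > 0`). [folklore] -/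
theorem innerCut_eq_zero_of_le {δ : ℝ} (hδ : 0 < δ) {U : GaugeConfig 3 L SU2} (h : δ ≤ orbitDist U) : innerCut δ U = 0 := by
  unfold innerCut
  rw [bump_eq_zero (by rw [le_div_iff₀ hδ]; linarith), mul_zero, Real.sin_zero]

/-- `innerCut δ U = 1` once `orbitDist U ≤ δ/2` (`δ > 0`). [folklore] -/
theorem innerCut_eq_one_of_le {δ : ℝ} (hδ : 0 < δ) {U : GaugeConfig 3 L SU2} (h : orbitDist U ≤ δ / 2) : innerCut δ U = 1 := by
  unfold innerCut
  rw [bump_eq_one (by rw [div_le_iff₀ hδ]; linarith), mul_one, Real.sin_pi_div_two]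

/-- The cut-off is supported in `{orbitDist U < δ}` (`δ > 0`). [folklore] -/
theorem orbitDist_lt_of_innerCut_ne_zero {δ : ℝ} (hδ : 0 < δ) {U : GaugeConfig 3 L SU2} (h : innerCut δ U ≠ 0) : orbitDist U < δ := by
  by_contra hle
  exact h (innerCut_eq_zero_of_le hδ (not_lt.mp hle))

/-- The cut-off is gauge invariant. [folklore] -/
theorem innerCut_gaugeTransform (δ : ℝ) (g : Site 3 L → SU2) (U : GaugeConfig 3 L SU2) :
    innerCut δ (gaugeTransform g U) = innerCut δ U := by
  unfold innerCut; rw [orbitDist_gaugeTransform]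

/-- The cut-off is measurable. [folklore] -/
theorem measurable_innerCut (δ : ℝ) : Measurable (innerCut (L := L) δ) := by
  unfold innerCut
  exact Real.continuous_sin.measurable.comp ((continuous_bump.measurable.comp (measurable_orbitDist.div_const δ)).const_mul _)

/-! ## §3 At most one inner neighbourhood is visited (`L·δ < 2`) -/

/-- ★ **The inner phase resolves into the eight one-orbit cut-offs**: for `L·δ < 2` (`δ > 0`),
`cos Θ_δ(U) = Σ_z innerCut δ (twist3 z U)` — at most one twisted orbit distance is `< δ` (`twist3_eq_of_orbitDist_lt`). [folklore] -/
theorem cos_innerPhase_eq_twistSum {δ : ℝ} (hδ : 0 < δ) (hLδ : (L : ℝ) * δ < 2) (U : GaugeConfig 3 L SU2) :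
    Real.cos (innerPhase δ U) = twistSum (innerCut δ) U := by
  unfold twistSum
  by_cases h : ∃ z : Fin 3 → Bool, orbitDist (TT.twist3 z U) < δ
  · obtain ⟨z0, hz0⟩ := h
    have hoth : ∀ z : Fin 3 → Bool, z ≠ z0 → δ ≤ orbitDist (TT.twist3 z U) := fun z hz => by
      by_contra hlt
      exact hz (twist3_eq_of_orbitDist_lt hLδ (not_le.mp hlt) hz0)
    have hprod : ∏ z : Fin 3 → Bool, (1 - bump (orbitDist (TT.twist3 z U) / δ)) = 1 - bump (orbitDist (TT.twist3 z0 U) / δ) := by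
      rw [← Finset.mul_prod_erase Finset.univ _ (Finset.mem_univ z0), Finset.prod_eq_one (fun z hz => ?_), mul_one]
      rw [bump_eq_zero (by rw [le_div_iff₀ hδ]; linarith [hoth z (Finset.ne_of_mem_erase hz)]), sub_zero]
    have hsum : ∑ z : Fin 3 → Bool, innerCut δ (TT.twist3 z U) = innerCut δ (TT.twist3 z0 U) := by
      rw [← Finset.add_sum_erase Finset.univ _ (Finset.mem_univ z0), Finset.sum_eq_zero (fun z hz => ?_), add_zero]
      exact innerCut_eq_zero_of_le hδ (hoth z (Finset.ne_of_mem_erase hz))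
    rw [innerPhase, hprod, hsum, innerCut, show π / 2 * (1 - bump (orbitDist (TT.twist3 z0 U) / δ)) =
      π / 2 - π / 2 * bump (orbitDist (TT.twist3 z0 U) / δ) by ring, Real.cos_pi_div_two_sub]
  · push Not at h
    have hprod : ∏ z : Fin 3 → Bool, (1 - bump (orbitDist (TT.twist3 z U) / δ)) = 1 :=
      Finset.prod_eq_one fun z _ => by rw [bump_eq_zero (by rw [le_div_iff₀ hδ]; linarith [h z]), sub_zero]
    have hsum : ∑ z : Fin 3 → Bool, innerCut δ (TT.twist3 z U) = 0 :=
      Finset.sum_eq_zero fun z _ => innerCut_eq_zero_of_le hδ (h z)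
    rw [innerPhase, hprod, mul_one, Real.cos_pi_div_two, hsum]

/-- ★ Hence the INNER piece of a physical `ψ` is a twist symmetrisation: `cos Θ_δ · ψ = twistSum (innerCut δ · ψ)` (`L·δ < 2`). [folklore] -/
theorem cos_innerPhase_mul_eq_twistSum {δ : ℝ} (hδ : 0 < δ) (hLδ : (L : ℝ) * δ < 2) {ψ : GaugeConfig 3 L SU2 → ℝ} (hψ : IsPhys ψ)
    (U : GaugeConfig 3 L SU2) : Real.cos (innerPhase δ U) * ψ U = twistSum (fun V => innerCut δ V * ψ V) U := by
  rw [twistSum_mul_of_isPhys _ hψ, cos_innerPhase_eq_twistSum hδ hLδ]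

/-- The localized factor `innerCut δ · ψ` of a physical `ψ`: measurable. [folklore] -/
theorem measurable_innerCut_mul (δ : ℝ) {ψ : GaugeConfig 3 L SU2 → ℝ} (hψ : IsPhys ψ) :
    Measurable fun V : GaugeConfig 3 L SU2 => innerCut δ V * ψ V :=
  (measurable_innerCut δ).mul hψ.measurable

/-- … bounded by the bound of `ψ`. [folklore] -/
theorem abs_innerCut_mul_le (δ : ℝ) {ψ : GaugeConfig 3 L SU2 → ℝ} {C : ℝ} (hC : ∀ U, |ψ U| ≤ C) (V : GaugeConfig 3 L SU2) :
    |innerCut δ V * ψ V| ≤ C := by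
  rw [abs_mul]
  calc |innerCut δ V| * |ψ V| ≤ 1 * |ψ V| := mul_le_mul_of_nonneg_right (abs_innerCut_le δ V) (abs_nonneg _)
    _ ≤ C := by rw [one_mul]; exact hC V

/-- … gauge invariant. [folklore] -/
theorem innerCut_mul_gaugeTransform (δ : ℝ) {ψ : GaugeConfig 3 L SU2 → ℝ} (hψ : IsPhys ψ) (g : Site 3 L → SU2) (V : GaugeConfig 3 L SU2) :
    innerCut δ (gaugeTransform g V) * ψ (gaugeTransform g V) = innerCut δ V * ψ V := by
  rw [innerCut_gaugeTransform, hψ.gaugeInv]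

/-- … and supported in `{orbitDist < δ}` (`δ > 0`). [folklore] -/
theorem orbitDist_lt_of_innerCut_mul_ne_zero {δ : ℝ} (hδ : 0 < δ) (ψ : GaugeConfig 3 L SU2 → ℝ) {V : GaugeConfig 3 L SU2}
    (h : innerCut δ V * ψ V ≠ 0) : orbitDist V < δ :=
  orbitDist_lt_of_innerCut_ne_zero hδ (left_ne_zero_of_mul h)

/-! ## §4 Disjoint copies: the `L²` norm of a twist symmetrisation -/

/-- Different twisted copies of a function supported in `{orbitDist < δ}` have disjoint supports (`L·δ < 2`). [folklore] -/
theorem twist_mul_twist_eq_zero {φ : GaugeConfig 3 L SU2 → ℝ} {δ : ℝ} (hLδ : (L : ℝ) * δ < 2) (hφ : ∀ U, φ U ≠ 0 → orbitDist U < δ)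
    {z z' : Fin 3 → Bool} (hne : z ≠ z') (U : GaugeConfig 3 L SU2) : φ (TT.twist3 z U) * φ (TT.twist3 z' U) = 0 := by
  by_contra h
  exact hne (twist3_eq_of_orbitDist_lt hLδ (hφ _ (left_ne_zero_of_mul h)) (hφ _ (right_ne_zero_of_mul h)))

/-- Hence `(twistSum φ)² = Σ_z (φ ∘ twist3 z)²` pointwise. [folklore] -/
theorem twistSum_mul_self {φ : GaugeConfig 3 L SU2 → ℝ} {δ : ℝ} (hLδ : (L : ℝ) * δ < 2) (hφ : ∀ U, φ U ≠ 0 → orbitDist U < δ)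
    (U : GaugeConfig 3 L SU2) : twistSum φ U * twistSum φ U = ∑ z : Fin 3 → Bool, φ (TT.twist3 z U) * φ (TT.twist3 z U) := by
  unfold twistSum
  rw [Finset.sum_mul_sum]
  refine Finset.sum_congr rfl fun z _ => ?_
  exact Finset.sum_eq_single z (fun z' _ hz' => twist_mul_twist_eq_zero hLδ hφ (Ne.symm hz') U) (fun h => absurd (Finset.mem_univ z) h)

/-- A bounded measurable real function is integrable for the a-priori measure. [folklore] -/
theorem integrable_of_bounded_lat {f : GaugeConfig 3 L SU2 → ℝ} (hm : Measurable f) {C : ℝ} (hC : ∀ U, |f U| ≤ C) :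
    Integrable f (configMeasure SU2 L) := by
  refine Integrable.of_bound (hm.aestronglyMeasurable) C (ae_of_all _ fun U => ?_)
  rw [Real.norm_eq_abs]; exact hC U

/-- ★ **`‖twistSum φ‖² = 8‖φ‖²`** for `φ` bounded, measurable and supported in `{orbitDist < δ}`, `L·δ < 2` (disjoint supports; the a-priori
measure is twist invariant). [folklore] -/
theorem l2_twistSum {φ : GaugeConfig 3 L SU2 → ℝ} (hm : Measurable φ) {C : ℝ} (hC : ∀ U, |φ U| ≤ C) {δ : ℝ} (hLδ : (L : ℝ) * δ < 2)
    (hφ : ∀ U, φ U ≠ 0 → orbitDist U < δ) : l2 (twistSum φ) (twistSum φ) = 8 * l2 φ φ := by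
  unfold l2
  simp_rw [twistSum_mul_self hLδ hφ]
  rw [integral_finsetSum _ fun z _ => ?_]
  · have hz : ∀ z : Fin 3 → Bool, ∫ U, φ (TT.twist3 z U) * φ (TT.twist3 z U) ∂configMeasure SU2 L = ∫ U, φ U * φ U ∂configMeasure SU2 L :=
      fun z => integral_comp_eq_of_measurePreserving (TT.measurePreserving_twist3 z) (F := fun U => φ U * φ U) (hm.mul hm)
    simp_rw [hz]
    simp
  · have hC0 : 0 ≤ C := (abs_nonneg _).trans (hC 1)
    refine integrable_of_bounded_lat ((hm.comp (TT.measurable_twist3 z)).mul (hm.comp (TT.measurable_twist3 z))) (C := C * C) fun U => ?_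
    rw [abs_mul]
    exact mul_le_mul (hC _) (hC _) (abs_nonneg _) hC0

/-- ★ In particular for the INNER piece of a physical `ψ` (`δ > 0`, `L·δ < 2`): `‖cos Θ_δ ψ‖² = 8 ‖innerCut δ · ψ‖²`. [folklore] -/
theorem l2_inner_eq {δ : ℝ} (hδ : 0 < δ) (hLδ : (L : ℝ) * δ < 2) {ψ : GaugeConfig 3 L SU2 → ℝ} (hψ : IsPhys ψ) :
    l2 (fun U => Real.cos (innerPhase δ U) * ψ U) (fun U => Real.cos (innerPhase δ U) * ψ U) =
      8 * l2 (fun V => innerCut δ V * ψ V) (fun V => innerCut δ V * ψ V) := by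
  obtain ⟨C, hC⟩ := hψ.bounded
  have hfun : (fun U => Real.cos (innerPhase δ U) * ψ U) = twistSum (fun V => innerCut δ V * ψ V) :=
    funext fun U => cos_innerPhase_mul_eq_twistSum hδ hLδ hψ U
  rw [hfun]
  exact l2_twistSum (measurable_innerCut_mul δ hψ) (abs_innerCut_mul_le δ hC) hLδ (fun U h => orbitDist_lt_of_innerCut_mul_ne_zero hδ ψ h)

end Summit.QuantumFields.YangMills.Theorems.FemtoTransferGap

end
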